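import Summits.BirchSwinnertonDyer.BirchSwinnertonDyer.Theses.BiquadraticEisensteinDescent
import Literature.NumberTheory.EllipticCurves.BSDSelmerCMPConverseGoldfeldProofs
import Literature.NumberTheory.EllipticCurves.BSDSelmerSmithCMTableProofs

/-!
# Sketch — crux-ideate seat 2 (g8), `stmt-BirchSwinnertonDyer-21381` `HeegnerTwistCouplingInSupply`

First-lemma signatures (and two small proved reductions) for the crux idea card
`goldfeld-density-one-switch`: Smith's `2^∞`-Selmer distribution law + Burungale–Tian's rank-zero
`2`-converse + Monsky's `2`-parity make the `L`-half of the crux hold OFF A NULL SET of square-free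
twists, so the crux follows from the W-free class-group statement "the `p`-indivisible Heegner
discriminants of level `N` are not a null set" (`NonNullIndivisibleHeegner`).
Planner sketch: nothing here is filed as a statement item. PROVED here (0 sorries):
`heegnerTwistEvenRank_of` (step (i): even analytic rank of Heegner twists of an analytic-rank-one
curve, from `even_analyticRank_iff` + the Heegner sign), `rankZeroOffNull_of` (the density-one
engine), `exists_indivisible_rankZero` (conull ∩ non-null ≠ ∅), `firstLemma_holds`, and
`cruxOfTransfer_holds : CruxOfTransfer` — the crux BY NAME from the per-`W` L-side package
(Smith's law, even rank of Heegner twists, currency `analyticRank = 0 → L(1) ≠ 0`), the named facts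
of Burungale–Tian and Monsky, and the W-free class-group statement `NonNullIndivisibleHeegnerAll`.
What is NOT proved: `NonNullIndivisibleHeegner N p` for any `p ≥ 5` (open), and the discharge of the
per-`W` package from the tree's CM table / continuation facts (S-sized typing).
-/

open scoped Classical
open Filter Topology
open Literature.NumberTheory.EllipticCurves

namespace Summit.BirchSwinnertonDyer.BirchSwinnertonDyer.Cruxes.HeegnerTwistCouplingInSupply.GoldfeldDensityOneSwitch

/-- The crux, by name. -/
abbrev Crux : Prop :=
  Summit.BirchSwinnertonDyer.BirchSwinnertonDyer.Theses.BiquadraticEisensteinDescent.HeegnerTwistCouplingInSupply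

/-- `d` is the discriminant of an imaginary quadratic field `K` with `|d_K| > 4` in which every
prime factor of `N` splits (the route's reading of the Heegner box). -/
def IsHeegnerDisc (N : ℕ) (d : ℤ) : Prop :=
  ∃ (K : Type) (_ : Field K) (_ : NumberField K), IsImaginaryQuadratic K ∧
    NumberField.discr K = d ∧ 4 < d.natAbs ∧ SatisfiesHeegnerHypothesis N K

/-- … and moreover `p ∤ h_K` (the SUPPLY side of the crux, W-free). -/
def IsIndivisibleHeegnerDisc (N p : ℕ) (d : ℤ) : Prop :=
  ∃ (K : Type) (_ : Field K) (_ : NumberField K), IsImaginaryQuadratic K ∧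
    NumberField.discr K = d ∧ 4 < d.natAbs ∧ SatisfiesHeegnerHypothesis N K ∧
    ¬ p ∣ NumberField.classNumber K

theorem isHeegnerDisc_of_isIndivisibleHeegnerDisc {N p : ℕ} {d : ℤ}
    (h : IsIndivisibleHeegnerDisc N p d) : IsHeegnerDisc N d := by
  obtain ⟨K, iF, iN, hK, hd, h4, hH, -⟩ := h
  exact ⟨K, iF, iN, hK, hd, h4, hH⟩

/-- **TRANSFER TARGET `C⁺(N, p)`.** The `p`-indivisible Heegner discriminants of level `N` are NOT
a density-zero subset of the square-free integers (tree currency `twistDensity`, both signs,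
ordered by `|d|`).  Open for `p ≥ 5` (Kohnen–Ono 1999 give `≫ √X / log X`; Beckwith–Raum–Richter
IMRN 2024 Thm 1 give existence); the `p = 3` analogue is Davenport–Heilbronn / Nakagawa–Horie. -/
def NonNullIndivisibleHeegner (N p : ℕ) : Prop :=
  ¬ twistDensity (IsIndivisibleHeegnerDisc N p) 0

/-- The W-free class-group conjecture the card moves the crux to: every level, every prime `p ≥ 5`
(Cohen–Lenstra with local conditions predicts relative density `∏_{k≥1}(1-p^{-k}) > 0`). -/
def NonNullIndivisibleHeegnerAll : Prop :=
  ∀ N p : ℕ, N ≠ 0 → p.Prime → 5 ≤ p → NonNullIndivisibleHeegner N p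

/-- **L-SIDE, density one.** Off a null set of square-free `d`, every Heegner discriminant `d` of
level `N_W` has `ord_{s=1} L(W^{(d)}, s) = 0`. -/
def RankZeroOffNull (W : WeierstrassCurve ℚ) : Prop :=
  twistDensity (fun d : ℤ ↦ IsHeegnerDisc (W.conductorNorm ℤ) d →
    (W.quadraticTwist (d : ℚ)).analyticRank = 0) 1

/-- Even analytic rank of the Heegner twists of an analytic-rank-one curve: `w(W) = -1`,
`w(W) w(W^{(d_K)}) = -1` under the Heegner hypothesis (Darmon 2004 Thm 3.17, tree module
`BSDHeegnerPointsSignProofs`), parity `Even r ↔ w = 1` (`WeierstrassCurve.even_analyticRank_iff`). -/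
def HeegnerTwistEvenRank (W : WeierstrassCurve ℚ) : Prop :=
  ∀ d : ℤ, IsHeegnerDisc (W.conductorNorm ℤ) d → Even (W.quadraticTwist (d : ℚ)).analyticRank

/-- **Proved bookkeeping 0 (step (i) of the card): even analytic rank of the Heegner twists of an
analytic-rank-one curve**, from the parity fact `Even r ↔ w = 1` for every `E/ℚ`
(`WeierstrassCurve.even_analyticRank_iff`, Silverman AEC Thm. C.16.3) and the Heegner sign
`w(E) · w(E^{(d_K)}) = −1` (Darmon 2004 Thm. 3.17; the hypothesis shape `hsign` of the tree's
`one_le_analyticRankEK_of`). -/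
theorem heegnerTwistEvenRank_of (W : WeierstrassCurve ℚ) [W.IsElliptic] (h1 : W.analyticRank = 1)
    (hpar : ∀ W' : WeierstrassCurve ℚ, W'.even_analyticRank_iff)
    (hsign : ∀ (K : Type) [Field K] [NumberField K], IsImaginaryQuadratic K →
      SatisfiesHeegnerHypothesis (W.conductorNorm ℤ) K →
        W.rootNumber * (W.quadraticTwist (NumberField.discr K : ℚ)).rootNumber = -1) :
    HeegnerTwistEvenRank W := by
  intro d hd
  obtain ⟨K, iF, iN, hK, hdK, -, hH⟩ := hd
  subst hdK
  have hdq : (NumberField.discr K : ℚ) ≠ 0 := by exact_mod_cast NumberField.discr_ne_zero K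
  haveI := W.isElliptic_quadraticTwist hdq
  have hs := hsign K hK hH
  have hw : W.rootNumber = -1 := by
    rcases W.rootNumber_eq_one_or with h | h
    · exact absurd ((hpar W).mpr h) (by rw [h1]; decide)
    · exact h
  rw [hw, neg_one_mul, neg_inj] at hs
  exact (hpar _).mpr hs

/-- **Proved bookkeeping 1 (the density-one engine, pattern of
`twistDensity_analyticRank_eq_zero_of_hasCM_of_burungaleTian`).** Smith's law for `W` + the
Burungale–Tian `2`-converse + Monsky `2`-parity + even rank of Heegner twists ⇒ `RankZeroOffNull W`. -/
theorem rankZeroOffNull_of (W : WeierstrassCurve ℚ) [W.IsElliptic] (hCM : W.HasCM)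
    (hS : smith_selmerCorank_density W)
    (hBT : burungaleTian_analyticRank_eq_zero_of_selmerCorank_eq_zero_of_hasCM)
    (hMon : monsky_selmerCorank_two_mod_two_eq) (hev : HeegnerTwistEvenRank W) :
    RankZeroOffNull W := by
  have hR := twistDensity_selmerCorankTwoInfty_le_one_of W hS
  refine twistDensity_one_mono (fun d _ hd hH ↦ ?_) hR
  obtain ⟨hd0, hle⟩ := hd
  have hd' : ((d : ℤ) : ℚ) ≠ 0 := by exact_mod_cast hd0
  haveI := W.isElliptic_quadraticTwist hd'
  have hCMd : (W.quadraticTwist (d : ℚ)).HasCM := hasCM_quadraticTwist_of_hasCM W hCM hd'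
  have hpar : (W.quadraticTwist (d : ℚ)).selmerCorank 2 % 2 =
      (W.quadraticTwist (d : ℚ)).analyticRank % 2 := hMon _
  rw [← selmerCorankTwoInfty_eq] at hpar
  have heven : Even (W.quadraticTwist (d : ℚ)).analyticRank := hev d hH
  obtain ⟨k, hk⟩ := heven
  have h0 : selmerCorankTwoInfty (W.quadraticTwist (d : ℚ)) = 0 := by omega
  exact hBT _ hCMd 2 ((selmerCorankTwoInfty_eq _).symm.trans h0)

/-- **Proved bookkeeping 2 (pigeonhole).** A density-one set meets every non-null set: if the
`L`-half holds off a null set and the `p`-indivisible Heegner discriminants of level `N_W` are not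
null, some Heegner `d` has both `p ∤ h(ℚ(√d))` and `ord_{s=1} L(W^{(d)}, s) = 0`. -/
theorem exists_indivisible_rankZero (W : WeierstrassCurve ℚ) (p : ℕ) (hR : RankZeroOffNull W)
    (hN : NonNullIndivisibleHeegner (W.conductorNorm ℤ) p) :
    ∃ d : ℤ, IsIndivisibleHeegnerDisc (W.conductorNorm ℤ) p d ∧
      (W.quadraticTwist (d : ℚ)).analyticRank = 0 := by
  by_contra h
  push Not at h
  apply hN
  have hc := hR.compl
  rw [sub_self] at hc
  exact hc.mono_zero fun d _ hI himp ↦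
    h d hI (himp (isHeegnerDisc_of_isIndivisibleHeegnerDisc hI))

/-- **FIRST LEMMA of the line (crux-shaped conclusion, analytic-rank currency).** In the crux's
corner, for CM curves covered by the tree's Smith table (`smith_selmerCorank_density W`; all
maximal CM `j` except `8000`), the W-free statement `NonNullIndivisibleHeegner N_W p` yields a
Heegner field `K` with `p ∤ h_K` and `ord_{s=1} L(W^{(d_K)}, s) = 0`.  (Conversion to the crux's
`entireLFunction 1 ≠ 0` is the landed continuation-price lemma, p606874.) -/
def FirstLemma : Prop :=
  ∀ (W : WeierstrassCurve ℚ) [W.IsElliptic] (p : ℕ) [Fact p.Prime], W.HasCM → W.analyticRank = 1 →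
    smith_selmerCorank_density W →
    burungaleTian_analyticRank_eq_zero_of_selmerCorank_eq_zero_of_hasCM →
    monsky_selmerCorank_two_mod_two_eq → HeegnerTwistEvenRank W →
    NonNullIndivisibleHeegner (W.conductorNorm ℤ) p →
    ∃ (K : Type) (_ : Field K) (_ : NumberField K), IsImaginaryQuadratic K ∧
      4 < (NumberField.discr K).natAbs ∧ SatisfiesHeegnerHypothesis (W.conductorNorm ℤ) K ∧
      (W.quadraticTwist (NumberField.discr K : ℚ)).analyticRank = 0 ∧
      ¬ p ∣ NumberField.classNumber K

theorem firstLemma_holds : FirstLemma := by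
  intro W _ p _ hCM _ hS hBT hMon hev hN
  obtain ⟨d, ⟨K, iF, iN, hK, hd, h4, hH, hcl⟩, hr⟩ :=
    exists_indivisible_rankZero W p (rankZeroOffNull_of W hCM hS hBT hMon hev) hN
  refine ⟨K, iF, iN, hK, ?_, hH, ?_, hcl⟩
  · rw [hd]; exact h4
  · rw [hd]; exact hr

/-- **The crux from the transfer target plus currency** (statement; the conversion
`analyticRank = 0 → entireLFunction 1 ≠ 0` for the CM twist is `analyticRank_eq_zero_iff` under
`HasEntireLFunction`, discharged for CM `j` by `hasEntireLFunction_of_j_mem_maximalCMJInvariants`). -/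
def CruxOfTransfer : Prop :=
  (∀ (W : WeierstrassCurve ℚ) [W.IsElliptic], W.HasCM → W.analyticRank = 1 →
      smith_selmerCorank_density W ∧ HeegnerTwistEvenRank W ∧
      ∀ d : ℤ, d ≠ 0 → (W.quadraticTwist (d : ℚ)).analyticRank = 0 →
        (W.quadraticTwist (d : ℚ)).entireLFunction 1 ≠ 0) →
  burungaleTian_analyticRank_eq_zero_of_selmerCorank_eq_zero_of_hasCM →
  monsky_selmerCorank_two_mod_two_eq →
  NonNullIndivisibleHeegnerAll → Crux

/-- **The transfer is honest**: `CruxOfTransfer` holds — the crux BY NAME follows from the packaged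
L-side inputs (Smith's law for the CM curve, even rank of its Heegner twists, currency), the two
named facts (Burungale–Tian, Monsky) and the W-free class-group statement C⁺. Kernel-checked. -/
theorem cruxOfTransfer_holds : CruxOfTransfer := by
  intro hpack hBT hMon hC W _ _ p _ _ hCM h1 h5 _ _ _
  obtain ⟨hS, hev, hcur⟩ := hpack W hCM h1
  have hN : W.conductorNorm ℤ ≠ 0 := NeZero.ne _
  obtain ⟨K, iF, iN, hK, h4, hH, hr, hcl⟩ :=
    firstLemma_holds W p hCM h1 hS hBT hMon hev (hC _ p hN Fact.out h5)
  refine ⟨K, iF, iN, hK, h4, hH, ?_, hcl⟩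
  exact hcur (NumberField.discr K) (NumberField.discr_ne_zero K) (by exact_mod_cast hr)

end Summit.BirchSwinnertonDyer.BirchSwinnertonDyer.Cruxes.HeegnerTwistCouplingInSupply.GoldfeldDensityOneSwitch
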